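import Literature.MathematicalPhysics.QuantumFieldTheory.Balaban1983to89.B2Eq265SmallCharge

/-!
# `Balaban1983to89.B2Eq265Dictionary` — [Balaban1982Higgs2] Lemma 2.4 (2.65) p.572: the (2.5) DICTIONARY STEP for the remainder
# of (2.65) on the (Higgs)₂,₃ carrier of record — pure real analysis of print's scale functions `p(ε) = b₀(1 + log ε⁻¹)ᵖ` ((2.2)),
# `r(ε) = R(1 + log ε⁻¹)ʳ` ((2.7)), `λ(ε) = λε^{4−d}`, `e(ε) = eε^{(4−d)/2}` ((2.5)) at the physical scale `s ⇐ Lᵏε`: the three non-tail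
# summands of F20 `B2Eq265SmallCharge`'s bound are `O(p(s)) + O(s^{κ₀})` with DISPLAYED constants (`dictionary_bound`)

statement-level skeleton of published theorems with citation tags; proofs where landed; nothing here is a claim
about the Yang–Mills mass gap

PDF held: `paper:balaban1982-cmp86-higgs23-ii` (journal page = PDF page + 554), p. 572 [PDF 18] (Lemma 2.4 (2.65); «Let us define
□₁, □₂ as the sums of large blocks contained in Λ₋₁^{(k−1)′} and distant from the point y less than 2r(Lᵏε), 4r(Lᵏε) respectively»;
«|A^{(k)}(x) − A^{(k)}(y)| ≦ O(p(Lᵏε)r(Lᵏε))»; (2.68) «+ O((Lᵏε)^{κ₀}), κ₀ > 0»), p. 573 [PDF 19] ((2.75)–(2.76) «= φ′(y) + O(p(Lᵏε))»),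
p. 557 [PDF 3] ((2.2) «p(ε) = b₀(1 + log ε⁻¹)ᵖ, p > 2»; (2.5) «λ(ε) = λε^{4−d}, e(ε) = eε^{(4−d)/2}»), p. 558 [PDF 4] ((2.7) «r(ε) =
R(1 + log ε⁻¹)ʳ … r > 1, R > R₀»), p. 570 [PDF 16] ((2.55)), p. 580 [PDF 26] ((2.109) «for … arbitrary κ»).

CITATION HEADER (lean-in-tree rule).  T. Bałaban, *(Higgs)₂,₃ quantum fields in a finite volume. II. An upper bound*,
Commun. Math. Phys. **86** (1982) 555–594, doi:10.1007/bf01214890 [Balaban1982Higgs2].  Cell `lit-balaban` (HOME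
`run/shared/lean/pub/lit-balaban/`), Phase-2 proof seat **p23** gen 24 (unit `lit-balaban-p23-g24`; free-target protocol G.5-34(d), TAKING #1
line HOME/STATUS.md 2026-08-23; r02 g49's OWNER RULING on reading question Q-p23g23-2, seat INBOX 2026-08-23T12:05:55Z); SKELETON row
**B2.Lem2.4** (fold owner r02, second reader r14; head `proved p250408 · …` UNCHANGED — cells-only member, brick F21a).  USED BY NAME, never
restated: own `B2Eq2108ErrorBound.thrPhi_pFn_eq`; r14's pattern `B2StepK.rDecayBeatsPowers` in the form of the typer's
`B2Sect3AGaussianStep.one_add_log_inv_rpow_mul_rpow_le`; b2b's `B2.pFn`, `B2.rFn`; the typer's `B2LargeField.lambdaEps`, `thrPhi`.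

THE ARGUMENT (print p.572–573: every error of (2.67), (2.68), (2.74)–(2.76) is «O(p(Lᵏε))» or «O((Lᵏε)^{κ₀})»).  After F20 the remainder of
(2.65) is `T1 + T2 + T3 + T4`: `T1 = C′a_k s^κ` (the (2.76) tail, done); `T2 = 4K₀dC₃a_k·(ℓ·c₁p(s/L))` (the `λ_A` line); `T3 =
t′·Y·[a_k(E₁ + 4K₀dC₃) + d + E₂a_k² + Y·a_k(E₂ + E₃a_k)]` with `t′ = c₁p(s/L)/λ(s/L)^{1/4}` (the (2.55)₄ threshold at `ℓ′ = s/L`) and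
`Y = c_reg e_c^β·d·S` (charge × side of `□₂`); `T4 = m²ℓ²/(a_k + m²ℓ²)·t′` (the (2.75) mass ratio).  With `u = 1 + log s⁻¹ ≥ 1`:
(i) `p(s/L) = b₀(1 + log L + log s⁻¹)ᵖ ≤ (1 + log L)ᵖ·p(s)` and `ℓ ≤ 1`, so `T2 ≤ [4K₀dC₃·a·c₁(1 + log L)ᵖ]·p(s)`; (ii) `t′ =
c₁λ^{−1/4}L^{(4−d)/4}·s^{−(4−d)/4}·p(s/L) ≤ T_c·uᵖ·s^{−(4−d)/4}`; (iii) `e_c ≤ ē·s^{(4−d)/2}` ((2.5) at `ε ⇐ Lᵏε = s`) and `S ≤ θ₃r(s)`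
(the side of `□₂`) give `Y ≤ Y₀·uʳ·s^{β(4−d)/2}`; (iv) `a(1 − L⁻²) ≤ a_k ≤ a` ([Balaban1982Higgs1] (2.15)) bounds the brackets; (v)
`m²ℓ² ≤ m₁²s²` gives `T4 ≤ (m₁²/a(1 − L⁻²))·s²·t′`; (vi) every monomial `u^q·s^e` with `e > κ₀` is `≤ max(1, q/(e − κ₀))^q·s^{κ₀}` on
`(0, 1]` — logarithms lose against powers at a rate inside the gap.  The gaps are `η₁ = β(4−d)/2 − (4−d)/4 − κ₀`, `η₂ = η₁ + β(4−d)/2`,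
`η₃ = 2 − (4−d)/4 − κ₀`, positive under the two EXPLICIT exponent conditions and `d ≤ 3`.

WHAT THIS FILE PROVES (kernel-checked, zero `sorry`; theorems only — NO definition, NO `Prop`-valued fact; axioms standard).
 **`pFn_div_le`** — `p(s/L) ≤ (1 + log L)ᵖ·p(s)` for `L ≥ 1`, `s ∈ (0, 1]`, `b₀, p ≥ 0`.
 **`absorb_le`** — `(1 + log s⁻¹)^q·s^e ≤ max(1, q/(e − κ₀))^q·s^{κ₀}` for `q > 0`, `e > κ₀`, `s ∈ (0, 1]`.
 **`tprime_le`** — `c₁p(s/L)/λ(s/L)^{1/4} ≤ (c₁λ^{−1/4}L^{(4−d)/4}(1 + log L)ᵖ)·p(s)·s^{−(4−d)/4}` (every `d`; `λ > 0`, `c₁, b₀, p ≥ 0`, `L ≥ 1`).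
 **`dictionary_bound`** — THE DICTIONARY STEP in abstract letters: for `d ≤ 3`, `L > 1`, `a > 0`, `b₀ ≥ 0`, `p > 0`, `R, r ≥ 0`, `λ > 0`,
 `c₁, c_reg, ē, θ₃, K, C₃, E₁, E₂, E₃ ≥ 0`, `β > 0`, any `m₁`, and `κ₀` with `κ₀ + (4−d)/4 < β(4−d)/2`, `κ₀ + (4−d)/4 < 2`, there are
 `C″, C‴ ≥ 0` (DISPLAYED in the proof: `C″ = 4KdC₃·a·c₁(1 + log L)ᵖ`; `C‴ = T_cY₀A_maxM₁ + T_cY₀²B_maxM₂ + (m₁²/a(1 − L⁻²))T_cM₃` with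
 `T_c = c₁λ^{−1/4}L^{(4−d)/4}(1 + log L)ᵖb₀`, `Y₀ = c_reg ē^β dθ₃R`, `A_max = a(E₁ + 4KdC₃) + d + E₂a²`, `B_max = a(E₂ + E₃a)`, `M_i =
 max(1, q_i/η_i)^{q_i}`, `q₁ = p + r`, `q₂ = p + 2r`, `q₃ = p`) such that for all `s ∈ (0,1]`, `a(1 − L⁻²) ≤ a_k ≤ a`, `ℓ ∈ (0,1]`,
 `0 < e_c ≤ ē s^{(4−d)/2}`, `0 ≤ S ≤ θ₃r(s)`, `m² ≥ 0` with `m²ℓ² ≤ m₁²s²`: `T2 + T3 + T4 ≤ C″·p(s) + C‴·s^{κ₀}` (the summands written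
 LITERALLY as in F20's `eq265_higgs_region_size_charge`, with `a_k, ℓ, K, d, S` letters).
 **`printed_exponents`** — the PRINTED INSTANCE `β = 1` (the errors of (2.68)/(2.76) are linear in `e(Lᵏε)`): for `d ≥ 1` and
 `κ₀ < (4−d)/4` both exponent conditions hold (`d = 2`: `κ₀ < ½`; `d = 3`: `κ₀ < ¼`; print p.572 says only «κ₀ > 0»).

HONEST SCOPE / DIFFERENCES FROM PRINT (recorded, not hidden).  (a) This is bookkeeping of print's «O(·)» symbols, not a new estimate: the
inputs `e_c ≤ ē s^{(4−d)/2}`, `S ≤ θ₃r(s)`, `m²ℓ² ≤ m₁²s²` are the (2.5)/(2.7)/(2.1) dictionary READ as hypotheses on free letters `ē`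
(print's coupling `e`), `θ₃` (print: `S = 8r(Lᵏε) + O(1)`, so `θ₃ = 8 + O(1)/R`), `m₁` (print's mass `m`); none is identified with a
carrier quantity here (Q-p23g23-1, Q-p23g23-2: the identifications are readings, not members).  (b) `β`, `c_reg` stay the FREE regularity pair of
F8's (I.2.23)-form hypothesis; the exponent condition is explicit; the printed instance is `β = 1`.  (c) `d ≤ 3` is print's «d = 2, 3»
(Theorem p.556); for `d ≥ 4` the (2.5) scaling is void.  (d) «O(p(Lᵏε))» of (2.65) absorbs `s^{κ₀} ≤ 1 ≤ p(s)/b₀` only as print's own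
bookkeeping; we keep the three groups apart.  NOT summit progress.
-/

noncomputable section

namespace Literature.MathematicalPhysics.QuantumFieldTheory.Balaban1983to89.B2Eq265Dictionary

open B2Eq2108ErrorBound (thrPhi_pFn_eq)
open B2Sect3AGaussianStep (one_add_log_inv_rpow_mul_rpow_le)

/-! ## §1 The scale functions under `ε ↦ ε/L` and against powers -/

/-- `p(s/L) ≤ (1 + log L)ᵖ·p(s)` on `(0, 1]` for `L ≥ 1` (`1 + log L + log s⁻¹ ≤ (1 + log L)(1 + log s⁻¹)`): the passage between
the (2.55) letter `L^{k−1}ε = s/L` and `Lᵏε = s` inside print's «O(1)p(Lᵏε)» (the `O(1)` depends on `L`).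
[cite: Balaban1982Higgs2, (2.2) p.557 «p(ε) = b₀(1 + log ε⁻¹)ᵖ», Lemma 2.4 proof p.572–573 «O(1)p(Lᵏε)»] -/
theorem pFn_div_le {b₀ p L s : ℝ} (hb : 0 ≤ b₀) (hp : 0 ≤ p) (hL : 1 ≤ L) (hs : 0 < s) (hs1 : s ≤ 1) :
    B2.pFn b₀ p (s / L) ≤ (1 + Real.log L) ^ p * B2.pFn b₀ p s := by
  have hL0 : 0 < L := lt_of_lt_of_le one_pos hL
  have hlogL : 0 ≤ Real.log L := Real.log_nonneg hL
  have hlogs : 0 ≤ Real.log s⁻¹ := Real.log_nonneg ((one_le_inv₀ hs).2 hs1)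
  have hrew : Real.log (s / L)⁻¹ = Real.log L + Real.log s⁻¹ := by
    rw [inv_div, div_eq_mul_inv, Real.log_mul hL0.ne' (inv_ne_zero hs.ne')]
  have h0 : 0 ≤ 1 + Real.log (s / L)⁻¹ := by rw [hrew]; linarith
  have hle : 1 + Real.log (s / L)⁻¹ ≤ (1 + Real.log L) * (1 + Real.log s⁻¹) := by
    rw [hrew]; nlinarith [mul_nonneg hlogL hlogs]
  unfold B2.pFn
  calc b₀ * (1 + Real.log (s / L)⁻¹) ^ p ≤ b₀ * ((1 + Real.log L) * (1 + Real.log s⁻¹)) ^ p :=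
        mul_le_mul_of_nonneg_left (Real.rpow_le_rpow h0 hle hp) hb
    _ = (1 + Real.log L) ^ p * (b₀ * (1 + Real.log s⁻¹) ^ p) := by
        rw [Real.mul_rpow (by linarith) (by linarith)]; ring

/-- logarithms lose against powers at a rate INSIDE the gap: `(1 + log s⁻¹)^q·s^e ≤ max(1, q/(e − κ₀))^q·s^{κ₀}` on `(0, 1]` for
`q > 0`, `e > κ₀` — the bookkeeping behind print's «+ O((Lᵏε)^{κ₀}), κ₀ > 0» (as (2.109) «arbitrary κ»: r14's `B2StepK.rDecayBeatsPowers`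
for `e^{−δ₁r}`; here the polynomial-in-log version over the typer's `B2Sect3AGaussianStep.one_add_log_inv_rpow_mul_rpow_le`).
[cite: Balaban1982Higgs2, (2.68) p.572 «+ O((Lᵏε)^{κ₀}), κ₀ > 0», (2.109) p.580] -/
theorem absorb_le {q e κ₀ s : ℝ} (hq : 0 < q) (he : κ₀ < e) (hs : 0 < s) (hs1 : s ≤ 1) :
    (1 + Real.log s⁻¹) ^ q * s ^ e ≤ (max 1 (q / (e - κ₀))) ^ q * s ^ κ₀ := by
  have h := one_add_log_inv_rpow_mul_rpow_le hq (sub_pos.2 he) hs hs1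
  have hsplit : s ^ e = s ^ (e - κ₀) * s ^ κ₀ := by
    rw [← Real.rpow_add hs]; ring_nf
  rw [hsplit, ← mul_assoc]
  exact mul_le_mul_of_nonneg_right h (Real.rpow_nonneg hs.le _)

/-- the (2.55)₄ threshold `t′ = c₁p(ℓ′)/λ(ℓ′)^{1/4}` at `ℓ′ = s/L` in power form with the logarithm KEPT: `t′ ≤
(c₁λ^{−1/4}L^{(4−d)/4}(1 + log L)ᵖ)·p(s)·s^{−(4−d)/4}` (every `d`; `λ(x) = λx^{4−d}` is the typer's `B2LargeField.lambdaEps`; own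
`B2Eq2108ErrorBound.thrPhi_pFn_eq` gives the exact power form, `pFn_div_le` the passage `s/L ↦ s`).
[cite: Balaban1982Higgs2, (2.55) p.570, (2.2)/(2.5) p.557] -/
theorem tprime_le {lam c₁ b₀ p L s : ℝ} (d : ℕ) (hlam : 0 < lam) (hc : 0 ≤ c₁) (hb : 0 ≤ b₀) (hp : 0 ≤ p)
    (hL : 1 ≤ L) (hs : 0 < s) (hs1 : s ≤ 1) :
    c₁ * (1 / (B2LargeField.lambdaEps lam (s / L) d) ^ (1 / 4 : ℝ)) * B2.pFn b₀ p (s / L)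
      ≤ (c₁ * lam ^ (-(1 / 4 : ℝ)) * L ^ (((4 : ℝ) - d) / 4) * (1 + Real.log L) ^ p)
          * B2.pFn b₀ p s * s ^ (-(((4 : ℝ) - d) / 4)) := by
  have hL0 : 0 < L := lt_of_lt_of_le one_pos hL
  have hx : 0 < s / L := div_pos hs hL0
  have h1 : c₁ * (1 / (B2LargeField.lambdaEps lam (s / L) d) ^ (1 / 4 : ℝ)) * B2.pFn b₀ p (s / L)
      = c₁ * B2LargeField.thrPhi lam (s / L) d (B2.pFn b₀ p (s / L)) := by
    unfold B2LargeField.thrPhi; ring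
  have h2 : (s / L) ^ (-(((4 : ℝ) - d) / 4)) = L ^ (((4 : ℝ) - d) / 4) * s ^ (-(((4 : ℝ) - d) / 4)) := by
    rw [Real.div_rpow hs.le hL0.le, Real.rpow_neg hL0.le ((((4 : ℝ) - d) / 4)), div_inv_eq_mul, mul_comm]
  have h3 := pFn_div_le hb hp hL hs hs1
  have h4 : 0 ≤ c₁ * lam ^ (-(1 / 4 : ℝ)) * (L ^ (((4 : ℝ) - d) / 4) * s ^ (-(((4 : ℝ) - d) / 4))) :=
    mul_nonneg (mul_nonneg hc (Real.rpow_nonneg hlam.le _))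
      (mul_nonneg (Real.rpow_nonneg hL0.le _) (Real.rpow_nonneg hs.le _))
  rw [h1, thrPhi_pFn_eq c₁ hlam hx d, h2]
  calc c₁ * lam ^ (-(1 / 4 : ℝ)) * (L ^ (((4 : ℝ) - d) / 4) * s ^ (-(((4 : ℝ) - d) / 4))) * B2.pFn b₀ p (s / L)
      ≤ c₁ * lam ^ (-(1 / 4 : ℝ)) * (L ^ (((4 : ℝ) - d) / 4) * s ^ (-(((4 : ℝ) - d) / 4)))
          * ((1 + Real.log L) ^ p * B2.pFn b₀ p s) := mul_le_mul_of_nonneg_left h3 h4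
    _ = _ := by ring

/-! ## §2 The dictionary step on F20's three non-tail summands -/

/-- **THE (2.5) DICTIONARY STEP FOR THE REMAINDER OF (2.65)** in abstract letters (`a_k, ℓ, e_c, S, m²` free reals under the
located hypotheses; `K` = the cube size `K₀` or `M` cast to `ℝ`): the three non-tail summands of F20
`B2Eq265SmallCharge.eq265_higgs_region_size_charge`'s bound, written literally, are `≤ C″·p(s) + C‴·s^{κ₀}` with `C″ = 4KdC₃·a·c₁(1 +
log L)ᵖ` and `C‴` the displayed sum of three products (header), both chosen from the fixed data only.  TYPED vs PRINTED: print
writes the whole remainder as «O(p(Lᵏε))» (with «O((Lᵏε)^{κ₀})», «O((Lᵏε)^κ)» on the way); here the `p(s)` group and the `s^{κ₀}` group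
are kept apart, the exponent condition on the free `β` of F8's regularity hypothesis is explicit (printed instance `β = 1`:
`printed_exponents`), and `d ≤ 3`. [cite: Balaban1982Higgs2, Lemma 2.4 (2.65) p.572; proof p.572 «A^{(k)} − A₀ = O(p(Lᵏε)r(Lᵏε))», «□₁, □₂ … distant from the point y less than 2r(Lᵏε), 4r(Lᵏε)», (2.68) «+ O((Lᵏε)^{κ₀}), κ₀ > 0»; p.573 (2.75)–(2.76) «+ O(p(Lᵏε))»]
[cite: Balaban1982Higgs2, (2.5) p.557 «λ(ε) = λε^{4−d}, e(ε) = eε^{(4−d)/2}», (2.2) p.557, (2.7) p.558, (2.55) p.570]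
[cite: Balaban1982Higgs1, (2.15) p.609 «a_k ↘ a_∞ = a(1 − L⁻²)»] -/
theorem dictionary_bound (d : ℕ) (hd3 : d ≤ 3) {L a b₀ p R r lam c₁ creg β ebar θ₃ m₁ κ₀ Kc C₃ E₁ E₂ E₃ : ℝ}
    (hL : 1 < L) (ha : 0 < a) (hb : 0 ≤ b₀) (hp : 0 < p) (hR : 0 ≤ R) (hr : 0 ≤ r) (hlam : 0 < lam) (hc₁ : 0 ≤ c₁)
    (hcreg : 0 ≤ creg) (hβ : 0 < β) (hebar : 0 ≤ ebar) (hθ₃ : 0 ≤ θ₃) (hKc : 0 ≤ Kc) (hC₃ : 0 ≤ C₃) (hE₁ : 0 ≤ E₁)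
    (hE₂ : 0 ≤ E₂) (hE₃ : 0 ≤ E₃)
    (hκ₁ : κ₀ + ((4 : ℝ) - d) / 4 < β * (((4 : ℝ) - d) / 2)) (hκ₂ : κ₀ + ((4 : ℝ) - d) / 4 < 2) :
    ∃ C'' C''' : ℝ, 0 ≤ C'' ∧ 0 ≤ C''' ∧
      ∀ {s ak ℓ ec S msq : ℝ}, 0 < s → s ≤ 1 → a * (1 - (L ^ 2)⁻¹) ≤ ak → ak ≤ a → 0 < ℓ → ℓ ≤ 1 →
        0 < ec → ec ≤ ebar * s ^ (((4 : ℝ) - d) / 2) → 0 ≤ S → S ≤ θ₃ * B2.rFn R r s → 0 ≤ msq → msq * ℓ ^ 2 ≤ m₁ ^ 2 * s ^ 2 →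
        4 * Kc * d * C₃ * ak * (ℓ * (c₁ * B2.pFn b₀ p (s / L)))
          + (c₁ * (1 / (B2LargeField.lambdaEps lam (s / L) d) ^ (1 / 4 : ℝ)) * B2.pFn b₀ p (s / L)) * (creg * ec ^ β * (d * S)) *
              (ak * (E₁ + 4 * Kc * d * C₃) + d + E₂ * ak ^ 2 + (creg * ec ^ β * (d * S)) * ak * (E₂ + E₃ * ak))
          + msq * ℓ ^ 2 / (ak + msq * ℓ ^ 2) *
              (c₁ * (1 / (B2LargeField.lambdaEps lam (s / L) d) ^ (1 / 4 : ℝ)) * B2.pFn b₀ p (s / L))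
        ≤ C'' * B2.pFn b₀ p s + C''' * s ^ κ₀ := by
  -- the exponents `q = (4−d)/4` of `t′`, `σ = (4−d)/2` of `e(·)`, and the three gaps
  obtain ⟨q, hq⟩ : ∃ q : ℝ, q = ((4 : ℝ) - d) / 4 := ⟨_, rfl⟩
  obtain ⟨σ, hσ⟩ : ∃ σ : ℝ, σ = ((4 : ℝ) - d) / 2 := ⟨_, rfl⟩
  have hdr : (d : ℝ) ≤ 3 := by exact_mod_cast hd3
  have hσ0 : 0 ≤ σ := by rw [hσ]; linarith
  have hσβ : 0 ≤ σ * β := mul_nonneg hσ0 hβ.le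
  have hη₁ : κ₀ < σ * β - q := by rw [hσ, hq]; linarith
  have hη₂ : κ₀ < 2 * (σ * β) - q := by linarith
  have hη₃ : κ₀ < 2 - q := by rw [hq]; linarith
  have hL0 : 0 < L := by linarith
  have hlgL : 1 ≤ 1 + Real.log L := by linarith [Real.log_nonneg hL.le]
  obtain ⟨amin, hamin⟩ : ∃ amin : ℝ, amin = a * (1 - (L ^ 2)⁻¹) := ⟨_, rfl⟩
  have hamin0 : 0 < amin := by
    have h2 : 1 < L ^ 2 := by nlinarith
    rw [hamin]; exact mul_pos ha (by linarith [inv_lt_one_of_one_lt₀ h2])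
  -- the displayed constants
  obtain ⟨Tc, hTc⟩ : ∃ Tc : ℝ, Tc = c₁ * lam ^ (-(1 / 4 : ℝ)) * L ^ q * (1 + Real.log L) ^ p * b₀ := ⟨_, rfl⟩
  obtain ⟨Y₀, hY₀⟩ : ∃ Y₀ : ℝ, Y₀ = creg * ebar ^ β * d * θ₃ * R := ⟨_, rfl⟩
  obtain ⟨Amax, hAmax⟩ : ∃ Amax : ℝ, Amax = a * (E₁ + 4 * Kc * d * C₃) + d + E₂ * a ^ 2 := ⟨_, rfl⟩
  obtain ⟨Bmax, hBmax⟩ : ∃ Bmax : ℝ, Bmax = a * (E₂ + E₃ * a) := ⟨_, rfl⟩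
  obtain ⟨M₁, hM₁⟩ : ∃ M₁ : ℝ, M₁ = max 1 ((p + r) / (σ * β - q - κ₀)) ^ (p + r) := ⟨_, rfl⟩
  obtain ⟨M₂, hM₂⟩ : ∃ M₂ : ℝ, M₂ = max 1 ((p + 2 * r) / (2 * (σ * β) - q - κ₀)) ^ (p + 2 * r) := ⟨_, rfl⟩
  obtain ⟨M₃, hM₃⟩ : ∃ M₃ : ℝ, M₃ = max 1 (p / (2 - q - κ₀)) ^ p := ⟨_, rfl⟩
  have hTc0 : 0 ≤ Tc := by
    rw [hTc]
    exact mul_nonneg (mul_nonneg (mul_nonneg (mul_nonneg hc₁ (Real.rpow_nonneg hlam.le _)) (Real.rpow_nonneg hL0.le _))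
      (Real.rpow_nonneg (by linarith) _)) hb
  have hY₀0 : 0 ≤ Y₀ := by rw [hY₀]; positivity
  have hAmax0 : 0 ≤ Amax := by rw [hAmax]; positivity
  have hBmax0 : 0 ≤ Bmax := by rw [hBmax]; positivity
  have hM₁0 : 0 ≤ M₁ := by rw [hM₁]; positivity
  have hM₂0 : 0 ≤ M₂ := by rw [hM₂]; positivity
  have hM₃0 : 0 ≤ M₃ := by rw [hM₃]; positivity
  refine ⟨4 * Kc * d * C₃ * a * c₁ * (1 + Real.log L) ^ p,
    Tc * Y₀ * Amax * M₁ + Tc * Y₀ ^ 2 * Bmax * M₂ + m₁ ^ 2 / amin * Tc * M₃,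
    mul_nonneg (by positivity) (Real.rpow_nonneg (by linarith) _), by positivity, ?_⟩
  intro s ak ℓ ec S msq hs hs1 hak1 hak2 hℓ hℓ1 hec hecle hS0 hS hmsq hm
  -- `u = 1 + log s⁻¹ ≥ 1`, `p(s) = b₀uᵖ`, `r(s) = Ruʳ`
  obtain ⟨u, hu⟩ : ∃ u : ℝ, u = 1 + Real.log s⁻¹ := ⟨_, rfl⟩
  have hu1 : 1 ≤ u := by rw [hu]; linarith [Real.log_nonneg ((one_le_inv₀ hs).2 hs1)]
  have hu0 : 0 < u := by linarith
  have hps : B2.pFn b₀ p s = b₀ * u ^ p := by rw [hu]; rfl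
  have hrs : B2.rFn R r s = R * u ^ r := by rw [hu]; rfl
  rw [← hamin] at hak1
  have hak0 : 0 < ak := lt_of_lt_of_le hamin0 hak1
  have hx : 0 < s / L := div_pos hs hL0
  have hx1 : s / L ≤ 1 := (div_le_self hs.le hL.le).trans hs1
  have hpl0 : 0 ≤ B2.pFn b₀ p (s / L) :=
    mul_nonneg hb (Real.rpow_nonneg (by linarith [Real.log_nonneg ((one_le_inv₀ hx).2 hx1)]) _)
  have hps0 : 0 ≤ B2.pFn b₀ p s := by rw [hps]; positivity
  -- (Q2a) the `λ_A` line: `T2 ≤ C″·p(s)` by `ℓ ≤ 1`, `a_k ≤ a`, `p(s/L) ≤ (1 + log L)ᵖp(s)`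
  have hpl : B2.pFn b₀ p (s / L) ≤ (1 + Real.log L) ^ p * B2.pFn b₀ p s := pFn_div_le hb hp.le hL.le hs hs1
  have hT2 : 4 * Kc * d * C₃ * ak * (ℓ * (c₁ * B2.pFn b₀ p (s / L)))
      ≤ (4 * Kc * d * C₃ * a * c₁ * (1 + Real.log L) ^ p) * B2.pFn b₀ p s := by
    calc 4 * Kc * d * C₃ * ak * (ℓ * (c₁ * B2.pFn b₀ p (s / L)))
        ≤ 4 * Kc * d * C₃ * a * (1 * (c₁ * ((1 + Real.log L) ^ p * B2.pFn b₀ p s))) :=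
          mul_le_mul (mul_le_mul_of_nonneg_left hak2 (by positivity))
            (mul_le_mul hℓ1 (mul_le_mul_of_nonneg_left hpl hc₁) (by positivity) zero_le_one)
            (by positivity) (by positivity)
      _ = (4 * Kc * d * C₃ * a * c₁ * (1 + Real.log L) ^ p) * B2.pFn b₀ p s := by ring
  -- the (2.55)₄ threshold: `0 ≤ t′ ≤ T_c·uᵖ·s^{−q}`
  have hq' : -(((4 : ℝ) - d) / 4) = -q := by rw [hq]
  have ht0 : 0 ≤ c₁ * (1 / (B2LargeField.lambdaEps lam (s / L) d) ^ (1 / 4 : ℝ)) * B2.pFn b₀ p (s / L) :=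
    mul_nonneg (mul_nonneg hc₁ (div_nonneg zero_le_one (Real.rpow_nonneg (B2LargeField.lambdaEps_pos hlam hx d).le _))) hpl0
  have htb : c₁ * (1 / (B2LargeField.lambdaEps lam (s / L) d) ^ (1 / 4 : ℝ)) * B2.pFn b₀ p (s / L)
      ≤ Tc * (u ^ p * s ^ (-q)) := by
    refine (tprime_le d hlam hc₁ hb hp.le hL.le hs hs1).trans (le_of_eq ?_)
    rw [hps, hTc, hq', hq]; ring
  have htb0 : 0 ≤ Tc * (u ^ p * s ^ (-q)) := ht0.trans htb
  -- (Q2b) the charge × side of `□₂`: `0 ≤ Y ≤ Y₀·uʳ·s^{σβ}` by `e_c ≤ ē s^σ` ((2.5)) and `S ≤ θ₃r(s)`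
  have hecβ : ec ^ β ≤ ebar ^ β * s ^ (σ * β) := by
    calc ec ^ β ≤ (ebar * s ^ (((4 : ℝ) - d) / 2)) ^ β := Real.rpow_le_rpow hec.le hecle hβ.le
      _ = ebar ^ β * s ^ (σ * β) := by
          rw [Real.mul_rpow hebar (Real.rpow_nonneg hs.le _), ← Real.rpow_mul hs.le, hσ]
  have hY0 : 0 ≤ creg * ec ^ β * (d * S) := by positivity
  have hYb : creg * ec ^ β * (d * S) ≤ Y₀ * (u ^ r * s ^ (σ * β)) := by
    have h1 : S ≤ θ₃ * (R * u ^ r) := by rw [← hrs]; exact hS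
    calc creg * ec ^ β * (d * S) ≤ creg * (ebar ^ β * s ^ (σ * β)) * (d * (θ₃ * (R * u ^ r))) :=
          mul_le_mul (mul_le_mul_of_nonneg_left hecβ hcreg) (mul_le_mul_of_nonneg_left h1 (Nat.cast_nonneg d))
            (by positivity) (by positivity)
      _ = Y₀ * (u ^ r * s ^ (σ * β)) := by rw [hY₀]; ring
  have hYb0 : 0 ≤ Y₀ * (u ^ r * s ^ (σ * β)) := hY0.trans hYb
  -- the brackets: `a(1 − L⁻²) ≤ a_k ≤ a`
  have hA0 : 0 ≤ ak * (E₁ + 4 * Kc * d * C₃) + d + E₂ * ak ^ 2 := by positivity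
  have hB0 : 0 ≤ ak * (E₂ + E₃ * ak) := by positivity
  have hA : ak * (E₁ + 4 * Kc * d * C₃) + d + E₂ * ak ^ 2 ≤ Amax := by rw [hAmax]; gcongr
  have hB : ak * (E₂ + E₃ * ak) ≤ Bmax := by rw [hBmax]; gcongr
  -- `T3 ≤ (T_cY₀A_maxM₁ + T_cY₀²B_maxM₂)·s^{κ₀}`: two monomials `u^{p+r}s^{σβ−q}`, `u^{p+2r}s^{2σβ−q}` absorbed inside their gaps
  have hm1 : u ^ p * s ^ (-q) * (u ^ r * s ^ (σ * β)) = u ^ (p + r) * s ^ (σ * β - q) := by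
    rw [mul_mul_mul_comm, ← Real.rpow_add hu0, ← Real.rpow_add hs]; ring_nf
  have hm2 : u ^ p * s ^ (-q) * (u ^ r * s ^ (σ * β)) * (u ^ r * s ^ (σ * β)) = u ^ (p + 2 * r) * s ^ (2 * (σ * β) - q) := by
    rw [hm1, mul_mul_mul_comm, ← Real.rpow_add hu0, ← Real.rpow_add hs]; ring_nf
  have ha1 : u ^ (p + r) * s ^ (σ * β - q) ≤ M₁ * s ^ κ₀ := by
    rw [hM₁, hu]; exact absorb_le (by linarith) hη₁ hs hs1
  have ha2 : u ^ (p + 2 * r) * s ^ (2 * (σ * β) - q) ≤ M₂ * s ^ κ₀ := by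
    rw [hM₂, hu]; exact absorb_le (by linarith) hη₂ hs hs1
  have hT3 : (c₁ * (1 / (B2LargeField.lambdaEps lam (s / L) d) ^ (1 / 4 : ℝ)) * B2.pFn b₀ p (s / L)) * (creg * ec ^ β * (d * S)) *
        (ak * (E₁ + 4 * Kc * d * C₃) + d + E₂ * ak ^ 2 + (creg * ec ^ β * (d * S)) * ak * (E₂ + E₃ * ak))
      ≤ (Tc * Y₀ * Amax * M₁ + Tc * Y₀ ^ 2 * Bmax * M₂) * s ^ κ₀ := by
    have h1 : (c₁ * (1 / (B2LargeField.lambdaEps lam (s / L) d) ^ (1 / 4 : ℝ)) * B2.pFn b₀ p (s / L)) * (creg * ec ^ β * (d * S)) *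
          (ak * (E₁ + 4 * Kc * d * C₃) + d + E₂ * ak ^ 2 + (creg * ec ^ β * (d * S)) * ak * (E₂ + E₃ * ak))
        ≤ (Tc * (u ^ p * s ^ (-q))) * (Y₀ * (u ^ r * s ^ (σ * β))) *
          (Amax + (Y₀ * (u ^ r * s ^ (σ * β))) * Bmax) := by
      refine mul_le_mul (mul_le_mul htb hYb hY0 htb0) ?_ (by positivity) (mul_nonneg htb0 hYb0)
      have h2 : (creg * ec ^ β * (d * S)) * ak * (E₂ + E₃ * ak) ≤ (Y₀ * (u ^ r * s ^ (σ * β))) * Bmax := by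
        rw [mul_assoc]; exact mul_le_mul hYb hB hB0 hYb0
      exact add_le_add hA h2
    have h3 : (Tc * (u ^ p * s ^ (-q))) * (Y₀ * (u ^ r * s ^ (σ * β))) * (Amax + (Y₀ * (u ^ r * s ^ (σ * β))) * Bmax)
        = Tc * Y₀ * Amax * (u ^ (p + r) * s ^ (σ * β - q)) + Tc * Y₀ ^ 2 * Bmax * (u ^ (p + 2 * r) * s ^ (2 * (σ * β) - q)) := by
      rw [← hm2, ← hm1]; ring
    rw [h3] at h1
    refine h1.trans ?_
    have h4 := mul_le_mul_of_nonneg_left ha1 (mul_nonneg (mul_nonneg hTc0 hY₀0) hAmax0)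
    have h5 := mul_le_mul_of_nonneg_left ha2 (mul_nonneg (mul_nonneg hTc0 (sq_nonneg Y₀)) hBmax0)
    calc Tc * Y₀ * Amax * (u ^ (p + r) * s ^ (σ * β - q)) + Tc * Y₀ ^ 2 * Bmax * (u ^ (p + 2 * r) * s ^ (2 * (σ * β) - q))
        ≤ Tc * Y₀ * Amax * (M₁ * s ^ κ₀) + Tc * Y₀ ^ 2 * Bmax * (M₂ * s ^ κ₀) := add_le_add h4 h5
      _ = (Tc * Y₀ * Amax * M₁ + Tc * Y₀ ^ 2 * Bmax * M₂) * s ^ κ₀ := by ring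
  -- (Q2c) the (2.75) mass ratio: `m²ℓ²/(a_k + m²ℓ²) ≤ m₁²s²/a(1 − L⁻²)`, then `s²·t′` is the monomial `uᵖs^{2−q}`
  have hfrac : msq * ℓ ^ 2 / (ak + msq * ℓ ^ 2) ≤ m₁ ^ 2 * s ^ 2 / amin := by
    have hx0 : 0 ≤ msq * ℓ ^ 2 := by positivity
    calc msq * ℓ ^ 2 / (ak + msq * ℓ ^ 2) ≤ msq * ℓ ^ 2 / ak :=
          div_le_div_of_nonneg_left hx0 hak0 (le_add_of_nonneg_right hx0)
      _ ≤ m₁ ^ 2 * s ^ 2 / amin := div_le_div₀ (by positivity) hm hamin0 hak1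
  have hm3 : s ^ 2 * (u ^ p * s ^ (-q)) = u ^ p * s ^ (2 - q) := by
    rw [← Real.rpow_two, mul_left_comm, ← Real.rpow_add hs]; ring_nf
  have ha3 : u ^ p * s ^ (2 - q) ≤ M₃ * s ^ κ₀ := by
    rw [hM₃, hu]; exact absorb_le hp hη₃ hs hs1
  have hT4 : msq * ℓ ^ 2 / (ak + msq * ℓ ^ 2) *
        (c₁ * (1 / (B2LargeField.lambdaEps lam (s / L) d) ^ (1 / 4 : ℝ)) * B2.pFn b₀ p (s / L))
      ≤ (m₁ ^ 2 / amin * Tc * M₃) * s ^ κ₀ := by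
    calc msq * ℓ ^ 2 / (ak + msq * ℓ ^ 2) *
          (c₁ * (1 / (B2LargeField.lambdaEps lam (s / L) d) ^ (1 / 4 : ℝ)) * B2.pFn b₀ p (s / L))
        ≤ (m₁ ^ 2 * s ^ 2 / amin) * (Tc * (u ^ p * s ^ (-q))) := mul_le_mul hfrac htb ht0 (by positivity)
      _ = m₁ ^ 2 / amin * Tc * (s ^ 2 * (u ^ p * s ^ (-q))) := by ring
      _ = m₁ ^ 2 / amin * Tc * (u ^ p * s ^ (2 - q)) := by rw [hm3]
      _ ≤ m₁ ^ 2 / amin * Tc * (M₃ * s ^ κ₀) := mul_le_mul_of_nonneg_left ha3 (by positivity)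
      _ = (m₁ ^ 2 / amin * Tc * M₃) * s ^ κ₀ := by ring
  -- assembling
  calc _ ≤ (4 * Kc * d * C₃ * a * c₁ * (1 + Real.log L) ^ p) * B2.pFn b₀ p s
        + (Tc * Y₀ * Amax * M₁ + Tc * Y₀ ^ 2 * Bmax * M₂) * s ^ κ₀ + (m₁ ^ 2 / amin * Tc * M₃) * s ^ κ₀ :=
        add_le_add (add_le_add hT2 hT3) hT4
    _ = _ := by ring

/-- **THE PRINTED INSTANCE of the exponent conditions**: print's errors in (2.68)/(2.76) are LINEAR in `e(Lᵏε)` (`β = 1`); then for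
`d ≥ 1` both conditions of `dictionary_bound` follow from `κ₀ < (4−d)/4` alone (`d = 2`: `κ₀ < ½`; `d = 3`: `κ₀ < ¼`) — print p.572
asks only «κ₀ > 0», so any `0 < κ₀ < (4−d)/4` is a faithful reading. [cite: Balaban1982Higgs2, (2.68) p.572 «+ O((Lᵏε)^{κ₀}), κ₀ > 0», (2.5) p.557] -/
theorem printed_exponents {d : ℕ} (hd : 1 ≤ d) {κ₀ : ℝ} (hκ : κ₀ < ((4 : ℝ) - d) / 4) :
    κ₀ + ((4 : ℝ) - d) / 4 < 1 * (((4 : ℝ) - d) / 2) ∧ κ₀ + ((4 : ℝ) - d) / 4 < 2 := by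
  have hdr : (1 : ℝ) ≤ d := by exact_mod_cast hd
  constructor <;> linarith

end Literature.MathematicalPhysics.QuantumFieldTheory.Balaban1983to89.B2Eq265Dictionary

end
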